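import Summits.BirchSwinnertonDyer.Rank1Residual.X11b.AnticyclotomicControlSplitImprimitive
import Summits.BirchSwinnertonDyer.Rank1Residual.X11b.AnticyclotomicTorsionCriterion
import HarnessLib

/-!
# X11b, route R1 — the canonical `Σ = Σ(N⁺)`: the places of `K` above `N⁺` away from `p`; it is
# finite, and anticyclotomic control for `Sel_𝔭^{Σ(N⁺)}` holds on `ChainLocus` with NO residual input

HONEST FRAMING (cell `b2b-bsdres`, run/shared/lean/b2b/bsd-rank1-residual/, verbatim in every
file): the goal of the cell is to DELETE the COMBINATION-SHAPED residual classes of the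
Birch–Swinnerton-Dyer formula for ALL analytic-rank `≤ 1` elliptic curves over `ℚ` — "full BSD
formula for every rank `≤ 1` curve in class `C`" assembled STRICTLY from published theorems — so
that the rank-`≤ 1` remainder becomes exactly the CONSTRUCTION-SHAPED classes, which are TYPED
(missing-input `Prop`s), NOT attempted. This is not "finishing BSD". Sub-cell
`b2b-bsdres-multr1-p1` (X11b, route R1 = Castella 2018 Thm. A re-proved along the author's
erratum); a RESEARCH ROUTE; no claim beyond the stated class; X11b stays CONSTRUCTION-SHAPED;
nothing here changes a label; no named fact is minted (one definition with body — a set of places —,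
proved theorems; no `sorry`).

## Why this file

`AnticyclotomicControlSplitImprimitive` (this gen) proved anticyclotomic control — `s` BIJECTIVE, no
residual input — for every `Σ ⊇ {v ∤ p : ℓ_v ∣ N_E, e(v|ℓ_v) = f(v|ℓ_v) = 1}`. This file names the
CANONICAL such set, Castella's `{w : w ∣ N⁺}` away from `p` (Cas18 §2.1: `N = N⁺N⁻`, `N⁺` the product of
the primes of `N` split in `K`; on an erratum field `N⁻ = q`):

* `nPlusPlaces W K p` — the finite places `v` of `K` with `v ∤ p`, `ℓ_v ∣ N_E` and `e = f = 1`
  (DEFINITION, a `Set`; nothing asserted);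
* `finite_setOf_under_eq` (quadratic `K`: at most two places above each rational place, tree
  trichotomy), `finite_setOf_primesEquiv_under_dvd`, **`nPlusPlaces_finite`** — `Σ(N⁺)` is FINITE;
* **`ChainLocus.controlMap_bijective_nPlus`** — on `ChainLocus`, for every imaginary quadratic `K`,
  degree-one `𝔭 ∣ p`, anticyclotomic `κ` with topological generator `γ`:
  `s : Sel_𝔭^{Σ(N⁺)}(K, E[p^∞]) → Sel_𝔭^{Σ(N⁺)}(K_∞, E[p^∞])^γ` is BIJECTIVE;
* **`ChainLocus.hasCharValuationAt_iff_card_base_nPlus`** — "`ord_p f_ac^{Σ(N⁺)}(0) = n`" ⟺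
  `#Sel_𝔭^{Σ(N⁺)}(K, E[p^∞]) = p^n · #H¹(Γ, Sel_𝔭^{Σ(N⁺)}(K_∞, E[p^∞]))` (finite), NO hypothesis left;
* **`ChainLocus.isTorsion_XAc_nPlus_of_finite`** — the TORSION clause of Cas18 Thm. 2.3 / erratum
  Thm. 1.1 for `X_ac^{Σ(N⁺)}` follows from the finiteness of Castella's Selmer group OVER `K`,
  `Sel_𝔭^{Σ(N⁺)}(K, E[p^∞])` (Greenberg's criterion, gen 9, through the bijective `s`); generic
  `XAc.isTorsion_of_finite_selmerAcBase_of_bijective`.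

What remains typed (unchanged): the passage `Σ(N⁺) → ∅` (Tamagawa factors `c_w^{(p)}`, `w ∣ N⁺`), the
Poitou–Tate count of `#Sel_𝔭(K, E[p^∞])`, `Sel_Γ = 0`, and the OPEN input (IMC∘BDP)@𝟙.

References: [Castella2018] §2.1, Def. 2.2, Thm. 2.3 (arXiv:1704.06608 p. 5); [JetchevSkinnerWan2017]
§3.3 (shape only); [GreenbergLNM1716] §1 p. 60, §3 pp. 85–90.
-/

noncomputable section

open scoped Classical

open NumberField IsDedekindDomain Field
open Literature.NumberTheory.EllipticCurves Literature.NumberTheory.EllipticCurves.GreenbergSelmer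
open Literature.NumberTheory.GaloisRepresentations IsDedekindDomain.HeightOneSpectrum

namespace Summit.BirchSwinnertonDyer.Rank1Residual.X11b.AcSelmer

/-! ## Torsion of `X_ac^Σ` from the finiteness of Castella's Selmer group over `K` -/

section Torsion

variable {K : Type} [Field K] [NumberField K] (E : WeierstrassCurve K) (p : ℕ) [Fact p.Prime]
  (κ : ZpExtension K p) (𝔭 : HeightOneSpectrum (𝓞 K)) (S : Set (HeightOneSpectrum (𝓞 K)))
  (γ : absoluteGaloisGroup K) [hγ : Fact (κ.IsTopGenerator γ)]

/-- **`Sel_𝔭^Σ(K, E[p^∞])` finite and `s` bijective ⟹ `X_ac^Σ(E[p^∞])` is a finitely generated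
`Λ`-TORSION module** (Greenberg's criterion `XAc.module_finite_and_isTorsion_of_finite_invariants`
with `Sel^γ ≅ Sel_𝔭^Σ(K, E[p^∞])` along `s`). [cite: GreenbergLNM1716, §1 p. 60 (after Conj. 1.3)] [cite: JetchevSkinnerWan2017, §3.3 (arXiv:1512.06894 §3.3.5) (shape only)] -/
theorem XAc.isTorsion_of_finite_selmerAcBase_of_bijective
    (hbij : Function.Bijective (controlMap E p κ 𝔭 S γ)) (hfin : Finite (selmerAcBase E p 𝔭 S)) :
    Module.Finite (IwasawaAlgebra p) (XAc E p κ 𝔭 S γ) ∧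
      Module.IsTorsion (IwasawaAlgebra p) (XAc E p κ 𝔭 S γ) :=
  XAc.module_finite_and_isTorsion_of_finite_invariants E p κ 𝔭 S γ
    ((finite_selmerAcBase_iff_of_bijective E p κ 𝔭 S γ hbij).mp hfin)

end Torsion

/-! ## Finiteness of sets of places of a quadratic field -/

section Places

variable (K : Type) [Field K] [NumberField K]

/-- **At most two places of a quadratic field lie above a place of `ℚ`**: the fibre
`{v : v ∩ ℚ = u}` is finite (it is `{w₁, w₂}` or `{w}`, tree `placesOver_trichotomy_of_finrank_eq_two`).
[cite: NeukirchANT1999, Ch. I (8.2)] -/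
theorem finite_setOf_under_eq (hK : Module.finrank ℚ K = 2) (u : HeightOneSpectrum (𝓞 ℚ)) :
    {v : HeightOneSpectrum (𝓞 K) | v.under (𝓞 ℚ) = u}.Finite := by
  rcases placesOver_trichotomy_of_finrank_eq_two K hK u with
    ⟨w₁, w₂, -, hset, -⟩ | ⟨w, hset, -, -⟩ | ⟨w, hset, -, -⟩
  · rw [hset]; exact (Set.finite_singleton w₂).insert w₁
  · rw [hset]; exact Set.finite_singleton w
  · rw [hset]; exact Set.finite_singleton w

/-- The places of `ℚ` whose prime divides a fixed `N ≠ 0` form a finite set. [folklore] -/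
theorem finite_setOf_primesEquiv_dvd {N : ℕ} (hN : N ≠ 0) :
    {u : HeightOneSpectrum (𝓞 ℚ) | (Rat.HeightOneSpectrum.primesEquiv u : ℕ) ∣ N}.Finite := by
  have hs : {n : ℕ | n ∣ N}.Finite := by
    refine (N.divisors.finite_toSet).subset fun n hn ↦ ?_
    exact Finset.mem_coe.mpr (Nat.mem_divisors.mpr ⟨hn, hN⟩)
  have e : {u : HeightOneSpectrum (𝓞 ℚ) | (Rat.HeightOneSpectrum.primesEquiv u : ℕ) ∣ N} =
      (fun u : HeightOneSpectrum (𝓞 ℚ) ↦ (Rat.HeightOneSpectrum.primesEquiv u : ℕ)) ⁻¹' {n | n ∣ N} :=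
    rfl
  rw [e]
  refine hs.preimage fun u _ u' _ huu' ↦ ?_
  exact Rat.HeightOneSpectrum.primesEquiv.injective (Subtype.ext huu')

/-- **The places of a quadratic field above the primes dividing `N ≠ 0` form a finite set.**
[cite: NeukirchANT1999, Ch. I (8.2)] -/
theorem finite_setOf_primesEquiv_under_dvd (hK : Module.finrank ℚ K = 2) {N : ℕ} (hN : N ≠ 0) :
    {v : HeightOneSpectrum (𝓞 K) |
      (Rat.HeightOneSpectrum.primesEquiv (v.under (𝓞 ℚ)) : ℕ) ∣ N}.Finite := by
  have e : {v : HeightOneSpectrum (𝓞 K) |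
      (Rat.HeightOneSpectrum.primesEquiv (v.under (𝓞 ℚ)) : ℕ) ∣ N} =
      (fun v : HeightOneSpectrum (𝓞 K) ↦ v.under (𝓞 ℚ)) ⁻¹'
        {u : HeightOneSpectrum (𝓞 ℚ) | (Rat.HeightOneSpectrum.primesEquiv u : ℕ) ∣ N} := rfl
  rw [e]
  exact (finite_setOf_primesEquiv_dvd hN).preimage' fun u _ ↦ finite_setOf_under_eq K hK u

end Places

end Summit.BirchSwinnertonDyer.Rank1Residual.X11b.AcSelmer

/-! ## Route R1: the canonical `Σ(N⁺)` -/

namespace Summit.BirchSwinnertonDyer.Rank1Residual.X11b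

section Def

open AcSelmer

variable (W : WeierstrassCurve ℚ) (K : Type) [Field K] [NumberField K] (p : ℕ)

/-- **`Σ(N⁺)`, the places of `K` above `N⁺` away from `p`**: the finite places `v` of `K` with
`v ∤ p`, `ℓ_v ∣ N_E` (`ℓ_v` the rational prime below `v`) and `e(v|ℓ_v) = f(v|ℓ_v) = 1` (`ℓ_v` splits
in the quadratic `K`). Cas18 §2.1: "`N = N⁺N⁻` with `N⁺` (resp. `N⁻`) the product of the prime factors
of `N` which are split (resp. inert or ramified) in `K`"; the `Σ` over which Thm. 2.3's Tamagawa term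
`∏_{w∣N⁺} c_w^{(p)}` runs. A set of places; nothing asserted. [cite: Castella2018, §2.1 and Thm. 2.3 (arXiv:1704.06608 p. 5)] -/
def nPlusPlaces : Set (HeightOneSpectrum (𝓞 K)) :=
  {v | ((p : ℕ) : 𝓞 K) ∉ v.asIdeal ∧
    (Rat.HeightOneSpectrum.primesEquiv (v.under (𝓞 ℚ)) : ℕ) ∣ W.conductorNorm ℤ ∧
      v.asIdeal.ramificationIdx (𝓞 ℚ) = 1 ∧ v.asIdeal.inertiaDeg (𝓞 ℚ) = 1}

variable {W K p}

/-- Membership in `Σ(N⁺)`. [cite: Castella2018, §2.1 (arXiv:1704.06608 p. 5)] -/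
theorem mem_nPlusPlaces_iff (v : HeightOneSpectrum (𝓞 K)) :
    v ∈ nPlusPlaces W K p ↔ ((p : ℕ) : 𝓞 K) ∉ v.asIdeal ∧
      (Rat.HeightOneSpectrum.primesEquiv (v.under (𝓞 ℚ)) : ℕ) ∣ W.conductorNorm ℤ ∧
        v.asIdeal.ramificationIdx (𝓞 ℚ) = 1 ∧ v.asIdeal.inertiaDeg (𝓞 ℚ) = 1 :=
  Iff.rfl

/-- **`Σ(N⁺)` is finite** for a quadratic `K` (finitely many primes divide `N_E ≠ 0`, at most two
places above each). [cite: Castella2018, §2.1 (arXiv:1704.06608 p. 5), "finite set `Σ` of places `w ∤ p`"] -/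
theorem nPlusPlaces_finite [W.IsElliptic] (hK : Module.finrank ℚ K = 2) :
    (nPlusPlaces W K p).Finite := by
  have hN : W.conductorNorm ℤ ≠ 0 := (WeierstrassCurve.conductorNorm_pos_holds W).ne'
  exact (finite_setOf_primesEquiv_under_dvd K hK hN).subset fun v hv ↦ hv.2.1

/-- `Σ(N⁺)` contains the places `v ∤ p` above the split primes of `N_E` (the hypothesis `hS` of
`ChainLocus.controlMap_bijective_of_conductor_split_subset`, tautologically). [cite: Castella2018, §2.1 (arXiv:1704.06608 p. 5)] -/
theorem mem_nPlusPlaces_of (v : HeightOneSpectrum (𝓞 K)) (hpv : ((p : ℕ) : 𝓞 K) ∉ v.asIdeal)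
    (hN : (Rat.HeightOneSpectrum.primesEquiv (v.under (𝓞 ℚ)) : ℕ) ∣ W.conductorNorm ℤ)
    (he : v.asIdeal.ramificationIdx (𝓞 ℚ) = 1) (hf : v.asIdeal.inertiaDeg (𝓞 ℚ) = 1) :
    v ∈ nPlusPlaces W K p :=
  ⟨hpv, hN, he, hf⟩

end Def

section RouteR1

open AcSelmer Literature.NumberTheory.EllipticCurves.Rank1Residual

variable {W : WeierstrassCurve ℚ} [W.IsElliptic] [W.IsGloballyMinimal] {K : Type} [Field K]
  [NumberField K] {p : ℕ} [Fact p.Prime]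

/-- **Route R1: anticyclotomic control for `Sel_𝔭^{Σ(N⁺)}`, NO residual input.** On `ChainLocus`, for
EVERY imaginary quadratic `K`, EVERY degree-one `𝔭 ∣ p`, every anticyclotomic `ℤ_p`-extension `κ` with
topological generator `γ`: `s : Sel_𝔭^{Σ(N⁺)}(K, E[p^∞]) → Sel_𝔭^{Σ(N⁺)}(K_∞, E[p^∞])^γ` is BIJECTIVE.
[cite: Castella2018, Thm. 2.3 (arXiv:1704.06608 p. 5) (shape only)] [cite: JetchevSkinnerWan2017, Thm. 3.3.1 (shape only)] [cite: GreenbergLNM1716, §3 pp. 85–90] -/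
theorem ChainLocus.controlMap_bijective_nPlus (h : ChainLocus W p) (hK : IsImaginaryQuadratic K)
    {κ : ZpExtension K p} (hκ : κ.IsAnticyclotomic) {γ : absoluteGaloisGroup K}
    (hγ : κ.IsTopGenerator γ) (𝔭 : HeightOneSpectrum (𝓞 K)) (h𝔭 : ((p : ℕ) : 𝓞 K) ∈ 𝔭.asIdeal)
    (he : 𝔭.asIdeal.ramificationIdx (𝓞 ℚ) = 1) (hf : 𝔭.asIdeal.inertiaDeg (𝓞 ℚ) = 1) :
    Function.Bijective (controlMap (W.baseChange K) p κ 𝔭 (nPlusPlaces W K p) γ) :=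
  h.controlMap_bijective_of_conductor_split_subset K hK hκ hγ 𝔭 h𝔭 he hf (nPlusPlaces W K p)
    (fun v hpv hN he1 hf1 ↦ mem_nPlusPlaces_of v hpv hN he1 hf1)

/-- **On an erratum field**: the same for every `𝔭 ∋ p` (degree one automatically).
[cite: Castella2018, §5 (arXiv:1704.06608 p. 12), choice of K, and Thm. 2.3 (p. 5) (shape only)] -/
theorem ChainLocus.controlMap_bijective_nPlus_of_isErratumField (h : ChainLocus W p) {q : ℕ}
    (hKf : IsErratumField W K q) (hpq : p ≠ q) (hpN : p ∣ W.conductorNorm ℤ) {κ : ZpExtension K p}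
    (hκ : κ.IsAnticyclotomic) {γ : absoluteGaloisGroup K} (hγ : κ.IsTopGenerator γ)
    (𝔭 : HeightOneSpectrum (𝓞 K)) (h𝔭 : ((p : ℕ) : 𝓞 K) ∈ 𝔭.asIdeal) :
    Function.Bijective (controlMap (W.baseChange K) p κ 𝔭 (nPlusPlaces W K p) γ) :=
  have hsplit : SplitsIn K p := hKf.2.2.1 p (Fact.out : p.Prime) hpN hpq
  h.controlMap_bijective_nPlus hKf.1 hκ hγ 𝔭 h𝔭
    (degreeOne_of_splitsIn hKf.1.1 hsplit h𝔭).1 (degreeOne_of_splitsIn hKf.1.1 hsplit h𝔭).2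

/-- **Route R1, counting form for `Σ(N⁺)`, NO hypothesis left** (finiteness of `Σ(N⁺)` discharged):
on `ChainLocus`, for every imaginary quadratic `K`, degree-one `𝔭 ∣ p`, anticyclotomic `κ` with
topological generator `γ`, and every `n`: "`ord_p f_ac^{Σ(N⁺)}(0) = n`" for the constructed
`X_ac^{Σ(N⁺)}(E[p^∞])` ⟺ `Sel_𝔭^{Σ(N⁺)}(K, E[p^∞])` is finite and
`#Sel_𝔭^{Σ(N⁺)}(K, E[p^∞]) = p^n · #H¹(Γ, Sel_𝔭^{Σ(N⁺)}(K_∞, E[p^∞]))`.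
[cite: Castella2018, Thm. 2.3 (arXiv:1704.06608 p. 5) (shape only)] [cite: JetchevSkinnerWan2017, §3.3.6 (shape only)] [cite: GreenbergLNM1716, §4 Lemma 4.2 (p. 102)] -/
theorem ChainLocus.hasCharValuationAt_iff_card_base_nPlus (h : ChainLocus W p)
    (hK : IsImaginaryQuadratic K) {κ : ZpExtension K p} (hκ : κ.IsAnticyclotomic)
    (γ : absoluteGaloisGroup K) [hγ : Fact (κ.IsTopGenerator γ)] (𝔭 : HeightOneSpectrum (𝓞 K))
    (h𝔭 : ((p : ℕ) : 𝓞 K) ∈ 𝔭.asIdeal) (he : 𝔭.asIdeal.ramificationIdx (𝓞 ℚ) = 1)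
    (hf : 𝔭.asIdeal.inertiaDeg (𝓞 ℚ) = 1) (n : ℕ) :
    XAc.HasCharValuationAt (W.baseChange K) p κ 𝔭 (nPlusPlaces W K p) γ n ↔
      ∃ _ : Finite (selmerAcBase (W.baseChange K) p 𝔭 (nPlusPlaces W K p)),
        Nat.card (selmerAcBase (W.baseChange K) p 𝔭 (nPlusPlaces W K p)) =
          p ^ n * Nat.card (IwasawaDual.EndCoinvariants
            (conjSelmerAc (W.baseChange K) p κ 𝔭 (nPlusPlaces W K p) γ - 1)) :=
  h.hasCharValuationAt_iff_card_base_of_conductor_split_subset K hK hκ γ 𝔭 h𝔭 he hf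
    (nPlusPlaces_finite hK.1) (fun v hpv hN he1 hf1 ↦ mem_nPlusPlaces_of v hpv hN he1 hf1) n

/-- **Route R1: the TORSION clause for `X_ac^{Σ(N⁺)}` from finiteness over `K`.** On `ChainLocus`, for
every imaginary quadratic `K`, degree-one `𝔭 ∣ p`, anticyclotomic `κ`, `γ`: if Castella's Selmer group
OVER `K`, `Sel_𝔭^{Σ(N⁺)}(K, E[p^∞])`, is finite, then `X_ac^{Σ(N⁺)}(E[p^∞])` is a finitely generated
`Λ`-torsion module — the torsion clause of Cas18 Thm. 2.3 / erratum Thm. 1.1 for `Σ = Σ(N⁺)`, reduced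
to a finiteness statement over `K` (JSW §3.3.5's one-sentence argument, on the constructed objects).
[cite: Castella2018, Thm. 2.3 (arXiv:1704.06608 p. 5) (shape only)] [cite: Castella2018Erratum, Thm. 1.1 (p. 1) (torsion clause; shape only)] [cite: GreenbergLNM1716, §1 p. 60] -/
theorem ChainLocus.isTorsion_XAc_nPlus_of_finite (h : ChainLocus W p) (hK : IsImaginaryQuadratic K)
    {κ : ZpExtension K p} (hκ : κ.IsAnticyclotomic) (γ : absoluteGaloisGroup K)
    [hγ : Fact (κ.IsTopGenerator γ)] (𝔭 : HeightOneSpectrum (𝓞 K))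
    (h𝔭 : ((p : ℕ) : 𝓞 K) ∈ 𝔭.asIdeal) (he : 𝔭.asIdeal.ramificationIdx (𝓞 ℚ) = 1)
    (hf : 𝔭.asIdeal.inertiaDeg (𝓞 ℚ) = 1)
    (hfin : Finite (selmerAcBase (W.baseChange K) p 𝔭 (nPlusPlaces W K p))) :
    Module.Finite (IwasawaAlgebra p) (XAc (W.baseChange K) p κ 𝔭 (nPlusPlaces W K p) γ) ∧
      Module.IsTorsion (IwasawaAlgebra p) (XAc (W.baseChange K) p κ 𝔭 (nPlusPlaces W K p) γ) :=
  XAc.isTorsion_of_finite_selmerAcBase_of_bijective (W.baseChange K) p κ 𝔭 (nPlusPlaces W K p) γ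
    (h.controlMap_bijective_nPlus hK hκ hγ.out 𝔭 h𝔭 he hf) hfin

end RouteR1

end Summit.BirchSwinnertonDyer.Rank1Residual.X11b

end
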